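import Summits.QuantumFields.BalabanUV.Beta.FP.TorusCompositeCovarianceTwoPolar

/-!
# `BalabanUV.Beta.FP.TorusStepInsertionPeriodicTwo` — road «FP» for binder row D1, ROUTE T: **THE ONE-STEP SECOND-ORDER INSERTION BI-JET `stepIns₂₂ w w′` ACTS ON
# PERIODIC 1-FORMS AS an1's ROOTED SECOND-ORDER KERNEL `vh2KerAt`, SYMMETRISED, AT (the form, the periodic lifts of the two weights)** — the order-2 twin of
# `FP/TorusStepInsertionPeriodic` (the (C1) chart-side junction, one step, second order; MEMO-g27-hQ-junction §4)

WHY.  Our ♭ composite second-order bi-jet `TorusCompositeCovarianceTwoPolar.compIns₂₂` (chain rule `compIns₂₂_succ`) is built from the ONE-STEP bi-jet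
`stepIns₂₂ M Lc r w w′ = Σ_b Σ_{b′} (w b · w′ b′) • (perF T (dper T (V^{b′} b.2 b.1))).submatrix ((coarsePt, inr), (·, inl))`, `T = fine Lc M`, whose lattice member
is the SECOND-BOND-PERIODISED SYMMETRISED ROOTED PAIR `V^{(κ′,u′)} κ u := Σ'_n ½ (vh₂SAt ρ Lc κ u κ′ (u′ + T∘n) + vh₂SAt ρ Lc κ′ (u′ + T∘n) κ u)` of an1's packed
second-order table `vh₂SAt ρ Lc = packVH (vh2KerAt …)` (`AveragingMixedJetTables`).  As at order 1 (`FP/TorusStepInsertionPeriodic`), whatever packaging an2's (C1)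
TABLES choose at order 2 (F5 of S-an2-g49-1 §3), the junction for OUR `compIns₂₂` passes through the entry unfolding typed here: the action of `stepIns₂₂` on
`fine Lc M`-periodic real 1-forms, written in an1's `vh2KerAt` BY NAME — chart-free, packaging-free (no `def`).

WHAT (generic `d`; box `M`, blocking `Lc`, `T = fine Lc M`; root `r ∈ box (d+1) Lc`; `B` a `T`-periodic real 1-form).
* §1 TWO ENGINES (kernel-generic).  **`sum_perZ_dper_mul_periodic_of_periodCov`**: for an insertion family `V κ u` JOINTLY INVARIANT under the period lattice
  (g24 `PeriodisedGaugeLegContacts`' letter `hVP`), finitely supported in the fluctuation slot (`hS`) and in the family bond (`hT`),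
  `Σ_{y ∈ pbox M} Σ_l perZ M (dper M (V κ u)) x y (inr μ) (inl l) · B l y = Σ'_m Σ'_z Σ_l V κ (u + M∘m) x z (inr μ) (inl l) · B l z` (the periodic-FORM twin of
  `sum_perZ_dper_mul_tgrad_of_law`); **`sum_mul_tsum_translate_eq_tsum_lift`**: for `F κ u` finitely supported in `u`,
  `Σ_b w b · Σ'_m F b.2 (b.1 + M∘m) = Σ'_u Σ_κ F κ u · w (wrapPt M u, κ)` (a torus weight over the copies of its bonds = the lattice sum against its PERIODIC LIFT);
  the finite-copy plumbing of R-5's `exists_finset_translate` is inlined (`Finset.preimage` along `translate_injective`), not re-declared.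
* §2 ONE PAIR OF TORUS BONDS: `vh₂SAt_zsmul_inr_inl ∕ pair_zsmul_inr_inl` (entries at a coarse multiplier site `Lc•x`: `off = 0`, `blk = x`), support lemmas, and
  **`sum_perF_dper_pair_mul_periodic`**: `Σ_{y,l} perF T (dper T (V^{(κ′,u′)} κ u)) (coarsePt x, inr κ₀) (y, inl l) · B l y
   = Σ'_m Σ'_n Σ'_z Σ_l ½ (vh2KerAt (toSite r) Lc κ₀ x (l,z) (κ, u+T∘m) (κ′, u′+T∘n) + vh2KerAt (toSite r) Lc κ₀ x (l,z) (κ′, u′+T∘n) (κ, u+T∘m)) · B l z`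
  (§1 with leaf-02 g25's `PeriodisedBorderWardContactTwo.borderT2_periodCov ∕ borderT2_inr_inl_eq_zero_of_not_mem_S ∕ _T`; BOTH bonds run over ALL their copies
  independently — the relative copy sum inside `stepIns₂₂` and `dper`'s simultaneous one recombine, g16's located (T-DEPER) remark).
* §3 THE WEIGHTED DOUBLE SUM: **`sum_stepIns₂₂_mul_periodic_eq_sum_bonds`** and **`sum_stepIns₂₂_mul_periodic`** —
  `Σ_q stepIns₂₂ M Lc r w w′ (x, κ₀) q · B q.2 q.1
   = Σ'_u Σ_κ (Σ'_{u′} Σ_{κ′} (Σ'_z Σ_l ½ (vh2KerAt (toSite r) Lc κ₀ x (l,z) (κ,u) (κ′,u′) + vh2KerAt (toSite r) Lc κ₀ x (l,z) (κ′,u′) (κ,u)) · B l z) · w′ (wrapPt T u′, κ′)) · w (wrapPt T u, κ)`: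
  `stepIns₂₂ w w′` ACTS ON PERIODIC FORMS AS an1's SYMMETRISED ROOTED SECOND-ORDER KERNEL of the coarse bond `(κ₀, x)` summed against (the form in the fluctuation
  bond, the periodic lifts of the two weights in the two background bonds); every sum finite (an1's `vh2Tab_eq_zero₁∕₂∕₃`: all three bonds in `Near Lc x`).
NOT HERE: the order-2 composite induction (R-8 `TorusCompositeInsertionPeriodicTwo`); any `perF` packaging; any chart; any estimate.

[folklore] finite sums + finitely supported `tsum` re-indexing BY NAME over OUR bookkeeping objects (`stepIns₂₂`, `perF ∕ perZ ∕ dper`, `coarsePt ∕ wrapPt ∕ nearBox`,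
leaf-02's `borderT2_*` letters) and an1's typed tables (`vh₂SAt = packVH vh2KerAt`, `vh2KerAt`, `vh2Tab_eq_zero₁∕₂∕₃`); no `def`, no `def … : Prop`, nothing cited,
0 sorry.  Nothing of the dictionary ∕ Bałaban's non-linear averages asserted beyond their typed linearisations (that the composite's second variation IS this chain
of one-step tables is an2's (C1) TABLE word, R-D1-g42-4); NO chart fixed; the (C1) TABLES, the seven letters, `hH ∕ hQ` untouched.

HONEST DEPENDENCY (page 1, mandatory): continuum YM on T⁴ ⇐ BetaPertH ∧ nine spine estimates (0/9 proved); BetaPertH ⇐ (D1) ∧ (D4) ∧ CAP+tail;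
G-an2-4 gates asym, D1 and NE2/3/4.  HONEST FRAMING (cell contract, verbatim): «discharging `BetaPertH` makes Bałaban's UV stability UNCONDITIONAL —
a real constructive-QFT result; it is NOT the continuum limit and NOT the Clay problem.»  ABSOLUTE RULE (cell charter, verbatim): «No internally-minted
statement may enter as a cited fact. Every hypothesis is either kernel-proved in this package or a verbatim quotation of a PUBLISHED theorem with page
reference. The manuscript(s) under audit are NOT citable for their own disputed steps — they are the thing under adjudication; programme-internal
(2001/route/tribunal) claims are never citable.»  0 estimates; 0∕4 row-D1 binders (hW, hR, D1Tel, D1Rep); NOT (T-ID), NOT (C1), NOT SDF, NOT D1,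
NOT BetaPertH, NOT continuum, NOT Clay.  D1 formalisation swarm LEAF PROVER 02 (b2b-balaban-beta-d1-formalise-leaf-02 gen 28), 2026-08-23.  No existing file touched.
-/

noncomputable section

open scoped BigOperators

namespace Summit.QuantumFields.BalabanUV.Beta.FP.TorusStepInsertionPeriodicTwo

open Matrix Finset
open Literature.Probability.LatticeModels (Torus.proj)
open Literature.MathematicalPhysics.QuantumFieldTheory
open Literature.MathematicalPhysics.QuantumFieldTheory.Balaban1983to89
open Literature.MathematicalPhysics.QuantumFieldTheory.Balaban1983to89.Beta
open B5Prop11Plancherel (fine)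
open B6Lemma24Torus (pbox mem_pbox wrap)
open B4TorusKernel.MultiPeriod (translate translate_apply translate_injective)
open B4Reflection242 (translate_translate)
open Summit.QuantumFields.BalabanUV.Beta.GAN24.DirichletExhaustionPeriodise (one_le_M)
open ExpKernelCalculus (MKer)
open AffineAveraging (Site Form1 box toSite)
open AveragingContours (off blk)
open AveragingHessianKernels (Bond Near packVH_inr_inl)
open AveragingMixedJetTables (vh2KerAt vh₂SAt)
open OneStepResolventKernel (Fib proj_zsmul quo_zsmul)
open LatticeForm (quo)
open Summit.QuantumFields.BalabanUV.Beta.BorderedHessian (off_eq_zero_iff_proj blk_eq_quo)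
open Summit.QuantumFields.BalabanUV.Beta.GAN24.KernelPeriodisation (wrap_translate)
open Summit.QuantumFields.BalabanUV.Beta.FP.KernelPeriodisationFib (Idx perF perF_apply perZ perZ_apply)
open Summit.QuantumFields.BalabanUV.Beta.FP.KernelPeriodisationFibLoc (dper dper_apply)
open Summit.QuantumFields.BalabanUV.Beta.FP.KernelPeriodisationFibTrace (tsum_sites_eq_sum_tsum)
open Summit.QuantumFields.BalabanUV.Beta.FP.TorusGaugeCovariance (nearBox mem_nearBox)
open Summit.QuantumFields.BalabanUV.Beta.FP.TorusGaugeCovariancePairing (wrapPt wrapPt_coe wrapPt_of_mem)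
open Summit.QuantumFields.BalabanUV.Beta.FP.TorusGaugeCovarianceCoarse (coarsePt coarsePt_coe)
open Summit.QuantumFields.BalabanUV.Beta.FP.PeriodisedBorderWardContactTwo (vh₂SAt_inr_inl_eq vh2KerAt_eq_zero_of_not_near pair_inr_inl_eq_zero_of_not_mem
  borderT2_periodCov borderT2_inr_inl_eq_zero_of_not_mem_S borderT2_inr_inl_eq_zero_of_not_mem_T)
open Summit.QuantumFields.BalabanUV.Beta.FP.TorusCompositeCovarianceTwoPolar (stepIns₂₂)

variable {d : ℕ}

/-! ## §1 Two engines: a period-covariant insertion family against a periodic form; a bond weight against the copies of its bonds -/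

section Engines

variable (M : Fin (d + 1) → ℕ) [∀ μ, NeZero (M μ)]

/-- [folklore] **`sum_perZ_dper_mul_periodic_of_periodCov` — A PERIOD-COVARIANT INSERTION FAMILY ACTS ON PERIODIC FORMS COPY BY COPY.**  Letters: `hVP` joint
invariance of `V` under the period lattice in (bond, sites); `hS` finite support of the `(inr, inl)` entries in the fluctuation slot; `hT` finite support in the
family bond for a fixed multiplier site; `hB` periodicity of the form.  Conclusion:
`Σ_{y ∈ pbox M} Σ_l perZ M (dper M (V κ u)) x y (inr μ) (inl l) · B l y = Σ'_m Σ'_z Σ_l V κ (u + M∘m) x z (inr μ) (inl l) · B l z` (every sum finite). -/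
theorem sum_perZ_dper_mul_periodic_of_periodCov (V : Fin (d + 1) → Site (d + 1) → MKer (d + 1) (Fib d)) (S T : Site (d + 1) → Finset (Site (d + 1)))
    (hVP : ∀ (κ : Fin (d + 1)) (u m x z : Site (d + 1)) (a c : Fib d), V κ (translate M u m) (translate M x m) (translate M z m) a c = V κ u x z a c)
    (hS : ∀ (κ : Fin (d + 1)) (u x : Site (d + 1)) (μ α : Fin (d + 1)), ∀ z ∉ S x, V κ u x z (Sum.inr μ) (Sum.inl α) = 0)
    (hT : ∀ (κ : Fin (d + 1)) (x z : Site (d + 1)) (μ α : Fin (d + 1)), ∀ u ∉ T x, V κ u x z (Sum.inr μ) (Sum.inl α) = 0)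
    (B : Form1 (d + 1) ℝ) (hB : ∀ (l : Fin (d + 1)) (y m : Site (d + 1)), B l (translate M y m) = B l y)
    (κ : Fin (d + 1)) (u x : Site (d + 1)) (μ : Fin (d + 1)) :
    ∑ y : ↥(pbox M), ∑ l : Fin (d + 1), perZ M (dper M (V κ u)) x (y : Site (d + 1)) (Sum.inr μ) (Sum.inl l) * B l (y : Site (d + 1))
      = ∑' m : Site (d + 1), ∑' z : Site (d + 1), ∑ l : Fin (d + 1), V κ (translate M u m) x z (Sum.inr μ) (Sum.inl l) * B l z := by
  -- the copies of the insertion bond that load the multiplier site `x` are finitely many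
  classical
  obtain ⟨F, hF⟩ : ∃ F : Finset (Site (d + 1)), ∀ m ∉ F, translate M u m ∉ T x :=
    ⟨(T x).preimage (fun m => translate M u m) (translate_injective (one_le_M M) u).injOn,
      fun m hm hh => hm (Finset.mem_preimage.2 hh)⟩
  -- one translated copy: `V κ u (x + M∘m) (z + M∘m) = V κ (u − M∘m) x z`
  have hcopy0 : ∀ (m z : Site (d + 1)) (a c : Fib d), V κ u (translate M x m) (translate M z m) a c = V κ (translate M u (-m)) x z a c := by
    intro m z a c
    have hu : translate M (translate M u (-m)) m = u := by
      rw [translate_translate, neg_add_cancel]; funext i; rw [translate_apply, Pi.zero_apply, mul_zero, add_zero]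
    rw [← hVP κ (translate M u (-m)) m x z a c, hu]
  have hdper : ∀ (z : Site (d + 1)) (l : Fin (d + 1)),
      dper M (V κ u) x z (Sum.inr μ) (Sum.inl l) = ∑ m ∈ F, V κ (translate M u m) x z (Sum.inr μ) (Sum.inl l) := fun z l => by
    have h0 : dper M (V κ u) x z (Sum.inr μ) (Sum.inl l) = ∑' m : Site (d + 1), V κ (translate M u m) x z (Sum.inr μ) (Sum.inl l) := by
      rw [dper_apply, ← (Equiv.neg (Site (d + 1))).tsum_eq fun m => V κ (translate M u m) x z (Sum.inr μ) (Sum.inl l)]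
      exact tsum_congr fun m => by rw [hcopy0, Equiv.neg_apply]
    rw [h0]
    exact tsum_eq_sum fun m hm => hT κ x z μ l _ (hF m hm)
  -- the periodised summand and its finite support in the fluctuation slot
  set H : Fin (d + 1) → Site (d + 1) → ℝ := fun l z => dper M (V κ u) x z (Sum.inr μ) (Sum.inl l) * B l z with hH
  have hHs : ∀ l, Summable (H l) := fun l =>
    summable_of_ne_finset_zero (s := S x) fun z hz => by
      simp only [hH]; rw [hdper, Finset.sum_eq_zero fun m _ => hS κ _ x μ l z hz, zero_mul]
  have hterm : ∀ (y : ↥(pbox M)) (l : Fin (d + 1)),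
      perZ M (dper M (V κ u)) x (y : Site (d + 1)) (Sum.inr μ) (Sum.inl l) * B l (y : Site (d + 1))
        = ∑' m : Site (d + 1), H l (translate M (y : Site (d + 1)) m) := fun y l => by
    rw [perZ_apply, ← tsum_mul_right]
    refine tsum_congr fun m => ?_
    simp only [hH]
    rw [hB]
  have hsm : ∀ m ∈ F, Summable fun z : Site (d + 1) => ∑ l : Fin (d + 1), V κ (translate M u m) x z (Sum.inr μ) (Sum.inl l) * B l z := fun m _ =>
    summable_of_ne_finset_zero (s := S x) fun z hz => Finset.sum_eq_zero fun l _ => by rw [hS κ _ x μ l z hz, zero_mul]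
  calc ∑ y : ↥(pbox M), ∑ l : Fin (d + 1), perZ M (dper M (V κ u)) x (y : Site (d + 1)) (Sum.inr μ) (Sum.inl l) * B l (y : Site (d + 1))
      = ∑ y : ↥(pbox M), ∑ l : Fin (d + 1), ∑' m : Site (d + 1), H l (translate M (y : Site (d + 1)) m) :=
        Finset.sum_congr rfl fun y _ => Finset.sum_congr rfl fun l _ => hterm y l
    _ = ∑ l : Fin (d + 1), ∑ y : ↥(pbox M), ∑' m : Site (d + 1), H l (translate M (y : Site (d + 1)) m) := Finset.sum_comm
    _ = ∑ l : Fin (d + 1), ∑' z : Site (d + 1), H l z := Finset.sum_congr rfl fun l _ => (tsum_sites_eq_sum_tsum M (hHs l)).symm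
    _ = ∑' z : Site (d + 1), ∑ l : Fin (d + 1), H l z := (Summable.tsum_finsetSum fun l _ => hHs l).symm
    _ = ∑' z : Site (d + 1), ∑ m ∈ F, ∑ l : Fin (d + 1), V κ (translate M u m) x z (Sum.inr μ) (Sum.inl l) * B l z := by
        refine tsum_congr fun z => ?_
        rw [Finset.sum_comm]
        exact Finset.sum_congr rfl fun l _ => by simp only [hH]; rw [hdper z l, Finset.sum_mul]
    _ = ∑ m ∈ F, ∑' z : Site (d + 1), ∑ l : Fin (d + 1), V κ (translate M u m) x z (Sum.inr μ) (Sum.inl l) * B l z := Summable.tsum_finsetSum hsm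
    _ = ∑' m : Site (d + 1), ∑' z : Site (d + 1), ∑ l : Fin (d + 1), V κ (translate M u m) x z (Sum.inr μ) (Sum.inl l) * B l z := by
        refine (tsum_eq_sum fun m hm => ?_).symm
        exact (tsum_congr fun z => Finset.sum_eq_zero fun l _ => by rw [hT κ x z μ l _ (hF m hm), zero_mul]).trans tsum_zero

/-- [folklore] **`sum_mul_tsum_translate_eq_tsum_lift` — A TORUS BOND WEIGHT SUMMED OVER THE COPIES OF ITS BONDS IS THE LATTICE SUM AGAINST ITS PERIODIC LIFT**:
for `F κ u` vanishing off a finite set in `u`, `Σ_b w b · Σ'_m F b.2 (b.1 + M∘m) = Σ'_u Σ_κ F κ u · w (wrapPt M u, κ)` (box × period lattice = lattice,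
`tsum_sites_eq_sum_tsum`; the lift reads the weight at the box representative, `wrap_translate`). -/
theorem sum_mul_tsum_translate_eq_tsum_lift (F : Fin (d + 1) → Site (d + 1) → ℝ) (S : Finset (Site (d + 1)))
    (hF : ∀ (κ : Fin (d + 1)), ∀ u ∉ S, F κ u = 0) (w : ↥(pbox M) × Fin (d + 1) → ℝ) :
    ∑ b : ↥(pbox M) × Fin (d + 1), w b * ∑' m : Site (d + 1), F b.2 (translate M (b.1 : Site (d + 1)) m)
      = ∑' u : Site (d + 1), ∑ κ : Fin (d + 1), F κ u * w (wrapPt M u, κ) := by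
  have hS : Summable fun u : Site (d + 1) => ∑ κ : Fin (d + 1), F κ u * w (wrapPt M u, κ) :=
    summable_of_ne_finset_zero (s := S) fun u hu => Finset.sum_eq_zero fun κ _ => by rw [hF κ u hu, zero_mul]
  rw [tsum_sites_eq_sum_tsum M hS, Fintype.sum_prod_type]
  refine Finset.sum_congr rfl fun y _ => ?_
  have hwrap : ∀ (m : Site (d + 1)) (κ : Fin (d + 1)), w (wrapPt M (translate M (y : Site (d + 1)) m), κ) = w (y, κ) := fun m κ => by
    congr 2
    exact Subtype.ext (wrap_translate M y.2 m)
  classical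
  obtain ⟨Fm, hFm⟩ : ∃ F : Finset (Site (d + 1)), ∀ m ∉ F, translate M (y : Site (d + 1)) m ∉ S :=
    ⟨(S).preimage (fun m => translate M (y : Site (d + 1)) m) (translate_injective (one_le_M M) (y : Site (d + 1))).injOn,
      fun m hm hh => hm (Finset.mem_preimage.2 hh)⟩
  have hfin : ∀ κ : Fin (d + 1), ∑' m : Site (d + 1), F κ (translate M (y : Site (d + 1)) m) = ∑ m ∈ Fm, F κ (translate M (y : Site (d + 1)) m) :=
    fun κ => tsum_eq_sum fun m hm => hF κ _ (hFm m hm)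
  calc ∑ κ : Fin (d + 1), w (y, κ) * ∑' m : Site (d + 1), F κ (translate M (y : Site (d + 1)) m)
      = ∑ κ : Fin (d + 1), ∑ m ∈ Fm, F κ (translate M (y : Site (d + 1)) m) * w (y, κ) := by
        refine Finset.sum_congr rfl fun κ _ => ?_
        rw [hfin, mul_comm, Finset.sum_mul]
    _ = ∑ m ∈ Fm, ∑ κ : Fin (d + 1), F κ (translate M (y : Site (d + 1)) m) * w (y, κ) := Finset.sum_comm
    _ = ∑' m : Site (d + 1), ∑ κ : Fin (d + 1), F κ (translate M (y : Site (d + 1)) m) * w (y, κ) :=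
        (tsum_eq_sum fun m hm => Finset.sum_eq_zero fun κ _ => by rw [hF κ _ (hFm m hm), zero_mul]).symm
    _ = ∑' m : Site (d + 1), ∑ κ : Fin (d + 1), F κ (translate M (y : Site (d + 1)) m) * w (wrapPt M (translate M (y : Site (d + 1)) m), κ) := by
        simp only [hwrap]

end Engines

/-! ## §2 One pair of torus bonds: the second-bond-periodised symmetrised rooted pair acts on periodic forms as `vh2KerAt`, copy by copy in both bonds -/

section Pair

variable (M : Fin (d + 1) → ℕ) [∀ μ, NeZero (M μ)] (Lc : ℕ) [NeZero Lc] {r : Fin (d + 1) → ℕ}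

/-- [folklore] **AT A COARSE MULTIPLIER SITE THE `(inr, inl)` ENTRY OF an1's PACKED SECOND-ORDER TABLE IS an1's KERNEL**:
`vh₂SAt ρ Lc κ u κ′ u′ (Lc•x) z (inr κ₀) (inl l) = vh2KerAt ρ Lc κ₀ x (l, z) (κ, u) (κ′, u′)` (`vh₂SAt_inr_inl_eq` at `off Lc (Lc•x) = 0`, `blk Lc (Lc•x) = x`). -/
theorem vh₂SAt_zsmul_inr_inl (ρ : Site (d + 1)) (κ : Fin (d + 1)) (u : Site (d + 1)) (κ' : Fin (d + 1)) (u' x z : Site (d + 1)) (κ₀ l : Fin (d + 1)) :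
    vh₂SAt ρ Lc κ u κ' u' ((Lc : ℤ) • x) z (Sum.inr κ₀) (Sum.inl l) = vh2KerAt ρ Lc κ₀ x (l, z) (κ, u) (κ', u') := by
  rw [vh₂SAt_inr_inl_eq, if_pos ((off_eq_zero_iff_proj _).2 (proj_zsmul (N := Lc) x)), blk_eq_quo, quo_zsmul (N := Lc)]

omit [∀ μ, NeZero (M μ)] in
/-- [folklore] … hence the second-bond-periodised symmetrised pair at a coarse multiplier site is the copy sum of the symmetrised kernel. -/
theorem pair_zsmul_inr_inl (ρ : Site (d + 1)) (κ : Fin (d + 1)) (u : Site (d + 1)) (κ' : Fin (d + 1)) (u' x z : Site (d + 1)) (κ₀ l : Fin (d + 1)) :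
    (∑' n : Site (d + 1), (1 / 2 : ℝ) * (vh₂SAt ρ Lc κ u κ' (translate (fine Lc M) u' n) ((Lc : ℤ) • x) z (Sum.inr κ₀) (Sum.inl l)
        + vh₂SAt ρ Lc κ' (translate (fine Lc M) u' n) κ u ((Lc : ℤ) • x) z (Sum.inr κ₀) (Sum.inl l)))
      = ∑' n : Site (d + 1), (1 / 2 : ℝ) * (vh2KerAt ρ Lc κ₀ x (l, z) (κ, u) (κ', translate (fine Lc M) u' n)
          + vh2KerAt ρ Lc κ₀ x (l, z) (κ', translate (fine Lc M) u' n) (κ, u)) :=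
  tsum_congr fun n => by rw [vh₂SAt_zsmul_inr_inl, vh₂SAt_zsmul_inr_inl]

omit [NeZero Lc] in
/-- [folklore] the symmetrised kernel vanishes when any of its three bonds is based off an1's box `Near Lc x` (`vh2KerAt_eq_zero_of_not_near`). -/
theorem symm_vh2KerAt_eq_zero_of_not_mem (hr : r ∈ box (d + 1) Lc) (κ₀ : Fin (d + 1)) (x : Site (d + 1)) {f g g' : Bond (d + 1)}
    (h : f.2 ∉ nearBox Lc x ∨ g.2 ∉ nearBox Lc x ∨ g'.2 ∉ nearBox Lc x) :
    (1 / 2 : ℝ) * (vh2KerAt (toSite r) Lc κ₀ x f g g' + vh2KerAt (toSite r) Lc κ₀ x f g' g) = 0 := by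
  rw [mem_nearBox, mem_nearBox, mem_nearBox] at h
  rcases h with h | h | h
  · rw [vh2KerAt_eq_zero_of_not_near hr κ₀ x (Or.inl h), vh2KerAt_eq_zero_of_not_near hr κ₀ x (Or.inl h)]; ring
  · rw [vh2KerAt_eq_zero_of_not_near hr κ₀ x (Or.inr (Or.inl h)), vh2KerAt_eq_zero_of_not_near hr κ₀ x (Or.inr (Or.inr h))]; ring
  · rw [vh2KerAt_eq_zero_of_not_near hr κ₀ x (Or.inr (Or.inr h)), vh2KerAt_eq_zero_of_not_near hr κ₀ x (Or.inr (Or.inl h))]; ring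

omit [NeZero Lc] in
/-- [folklore] the lattice pairing of the symmetrised kernel with any form vanishes when either background bond is based off an1's box. -/
theorem tsum_symm_vh2KerAt_mul_eq_zero_of_not_mem (hr : r ∈ box (d + 1) Lc) (κ₀ : Fin (d + 1)) (x : Site (d + 1)) {g g' : Bond (d + 1)}
    (h : g.2 ∉ nearBox Lc x ∨ g'.2 ∉ nearBox Lc x) (B : Form1 (d + 1) ℝ) :
    ∑' z : Site (d + 1), ∑ l : Fin (d + 1), (1 / 2 : ℝ) * (vh2KerAt (toSite r) Lc κ₀ x (l, z) g g' + vh2KerAt (toSite r) Lc κ₀ x (l, z) g' g) * B l z = 0 := by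
  refine (tsum_congr fun z => ?_).trans tsum_zero
  exact Finset.sum_eq_zero fun l _ => by rw [symm_vh2KerAt_eq_zero_of_not_mem Lc hr κ₀ x (Or.inr h), zero_mul]

omit [NeZero Lc] in
/-- [folklore] the symmetrised kernel against a form is summable in the fluctuation site (finite support `Near Lc x`). -/
theorem summable_sum_symm_vh2KerAt_mul (hr : r ∈ box (d + 1) Lc) (κ₀ : Fin (d + 1)) (x : Site (d + 1)) (g g' : Bond (d + 1)) (B : Form1 (d + 1) ℝ) :
    Summable fun z : Site (d + 1) => ∑ l : Fin (d + 1), (1 / 2 : ℝ) * (vh2KerAt (toSite r) Lc κ₀ x (l, z) g g' + vh2KerAt (toSite r) Lc κ₀ x (l, z) g' g) * B l z :=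
  summable_of_ne_finset_zero (s := nearBox Lc x) fun z hz =>
    Finset.sum_eq_zero fun l _ => by rw [symm_vh2KerAt_eq_zero_of_not_mem Lc hr κ₀ x (f := (l, z)) (Or.inl hz), zero_mul]

/-- [folklore] **`sum_perF_dper_pair_mul_periodic` — THE TORUS INSERTION OF THE SECOND-BOND-PERIODISED SYMMETRISED ROOTED PAIR AT ONE PAIR OF TORUS BONDS ACTS ON
PERIODIC FORMS AS an1's SYMMETRISED SECOND-ORDER KERNEL, COPY BY COPY IN BOTH BONDS** (`r ∈ box`; `B` `fine Lc M`-periodic; `x ∈ pbox M`, `κ₀`; statement below). -/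
theorem sum_perF_dper_pair_mul_periodic (hr : r ∈ box (d + 1) Lc) (κ : Fin (d + 1)) (u : Site (d + 1)) (κ' : Fin (d + 1)) (u' : Site (d + 1))
    (B : Form1 (d + 1) ℝ) (hB : ∀ (l : Fin (d + 1)) (y m : Site (d + 1)), B l (translate (fine Lc M) y m) = B l y) (x : ↥(pbox M)) (κ₀ : Fin (d + 1)) :
    ∑ y : ↥(pbox (fine Lc M)), ∑ l : Fin (d + 1),
        perF (fine Lc M) (dper (fine Lc M) (fun x z a c => ∑' n : Site (d + 1), (1 / 2 : ℝ) *
          (vh₂SAt (toSite r) Lc κ u κ' (translate (fine Lc M) u' n) x z a c + vh₂SAt (toSite r) Lc κ' (translate (fine Lc M) u' n) κ u x z a c)))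
          (coarsePt M Lc x, Sum.inr κ₀) (y, Sum.inl l) * B l (y : Site (d + 1))
      = ∑' m : Site (d + 1), ∑' n : Site (d + 1), ∑' z : Site (d + 1), ∑ l : Fin (d + 1),
          (1 / 2 : ℝ) * (vh2KerAt (toSite r) Lc κ₀ (x : Site (d + 1)) (l, z) (κ, translate (fine Lc M) u m) (κ', translate (fine Lc M) u' n)
            + vh2KerAt (toSite r) Lc κ₀ (x : Site (d + 1)) (l, z) (κ', translate (fine Lc M) u' n) (κ, translate (fine Lc M) u m)) * B l z := by
  have hM : ∀ i, fine Lc M i = Lc * M i := fun i => rfl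
  -- the engine, at the pair family `V κ u` of the second torus bond `(κ′, u′)`
  have step := sum_perZ_dper_mul_periodic_of_periodCov (fine Lc M)
    (fun κ u x z a c => ∑' n : Site (d + 1), (1 / 2 : ℝ) *
      (vh₂SAt (toSite r) Lc κ u κ' (translate (fine Lc M) u' n) x z a c + vh₂SAt (toSite r) Lc κ' (translate (fine Lc M) u' n) κ u x z a c))
    (fun x => nearBox Lc (blk Lc x)) (fun x => nearBox Lc (blk Lc x)) (borderT2_periodCov κ' u' hM rfl)
    (fun κ u x μ α => borderT2_inr_inl_eq_zero_of_not_mem_S hr κ' u' rfl κ u x μ α)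
    (fun κ x z μ α => borderT2_inr_inl_eq_zero_of_not_mem_T hr κ' u' rfl κ x z μ α) B hB κ u
    ((coarsePt M Lc x : ↥(pbox (fine Lc M))) : Site (d + 1)) κ₀
  simp only [perF_apply]
  rw [step]
  refine tsum_congr fun m => ?_
  -- the symmetrised kernel along the copies of the second bond (first bond at its `m`-th copy)
  set K : Site (d + 1) → Site (d + 1) → Fin (d + 1) → ℝ := fun n z l => (1 / 2 : ℝ) *
    (vh2KerAt (toSite r) Lc κ₀ (x : Site (d + 1)) (l, z) (κ, translate (fine Lc M) u m) (κ', translate (fine Lc M) u' n)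
      + vh2KerAt (toSite r) Lc κ₀ (x : Site (d + 1)) (l, z) (κ', translate (fine Lc M) u' n) (κ, translate (fine Lc M) u m)) with hK
  -- at the coarse multiplier site the pair entry is the copy sum of the symmetrised kernel
  have hentry : ∀ (z : Site (d + 1)) (l : Fin (d + 1)),
      (fun x z a c => ∑' n : Site (d + 1), (1 / 2 : ℝ) *
        (vh₂SAt (toSite r) Lc κ (translate (fine Lc M) u m) κ' (translate (fine Lc M) u' n) x z a c
          + vh₂SAt (toSite r) Lc κ' (translate (fine Lc M) u' n) κ (translate (fine Lc M) u m) x z a c))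
        ((coarsePt M Lc x : ↥(pbox (fine Lc M))) : Site (d + 1)) z (Sum.inr κ₀) (Sum.inl l) = ∑' n : Site (d + 1), K n z l := fun z l => by
    simp only [hK, coarsePt_coe]
    exact pair_zsmul_inr_inl M Lc (toSite r) κ _ κ' u' _ z κ₀ l
  -- the copies of the second bond loading the block of `x` are finitely many; swap the finite copy sum out
  classical
  obtain ⟨Fn, hFn⟩ : ∃ F : Finset (Site (d + 1)), ∀ m ∉ F, translate (fine Lc M) u' m ∉ nearBox Lc (x : Site (d + 1)) :=
    ⟨(nearBox Lc (x : Site (d + 1))).preimage (fun m => translate (fine Lc M) u' m) (translate_injective (one_le_M (fine Lc M)) u').injOn,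
      fun m hm hh => hm (Finset.mem_preimage.2 hh)⟩
  have hK0 : ∀ n ∉ Fn, ∀ (z : Site (d + 1)) (l : Fin (d + 1)), K n z l = 0 := fun n hn z l =>
    symm_vh2KerAt_eq_zero_of_not_mem Lc hr κ₀ _ (g' := (κ', translate (fine Lc M) u' n)) (Or.inr (Or.inr (hFn n hn)))
  have hfin : ∀ (z : Site (d + 1)) (l : Fin (d + 1)), ∑' n : Site (d + 1), K n z l = ∑ n ∈ Fn, K n z l := fun z l =>
    tsum_eq_sum fun n hn => hK0 n hn z l
  calc ∑' z : Site (d + 1), ∑ l : Fin (d + 1),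
        (fun x z a c => ∑' n : Site (d + 1), (1 / 2 : ℝ) *
          (vh₂SAt (toSite r) Lc κ (translate (fine Lc M) u m) κ' (translate (fine Lc M) u' n) x z a c
            + vh₂SAt (toSite r) Lc κ' (translate (fine Lc M) u' n) κ (translate (fine Lc M) u m) x z a c))
          ((coarsePt M Lc x : ↥(pbox (fine Lc M))) : Site (d + 1)) z (Sum.inr κ₀) (Sum.inl l) * B l z
      = ∑' z : Site (d + 1), ∑ n ∈ Fn, ∑ l : Fin (d + 1), K n z l * B l z := by
        refine tsum_congr fun z => ?_
        rw [Finset.sum_comm]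
        exact Finset.sum_congr rfl fun l _ => by rw [hentry z l, hfin z l, Finset.sum_mul]
    _ = ∑ n ∈ Fn, ∑' z : Site (d + 1), ∑ l : Fin (d + 1), K n z l * B l z :=
        Summable.tsum_finsetSum fun n _ => summable_sum_symm_vh2KerAt_mul Lc hr κ₀ _ _ _ B
    _ = ∑' n : Site (d + 1), ∑' z : Site (d + 1), ∑ l : Fin (d + 1), K n z l * B l z :=
        (tsum_eq_sum fun n hn => (tsum_congr fun z => Finset.sum_eq_zero fun l _ => by rw [hK0 n hn z l, zero_mul]).trans tsum_zero).symm

end Pair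

/-! ## §3 The weighted double sum: `stepIns₂₂ w w′` acts on periodic forms as the symmetrised `vh2KerAt` at (the form, the two periodic lifts) -/

section Step

variable (M : Fin (d + 1) → ℕ) [∀ μ, NeZero (M μ)] (Lc : ℕ) [NeZero Lc] {r : Fin (d + 1) → ℕ}

/-- [folklore] **`sum_stepIns₂₂_mul_periodic_eq_sum_bonds` — THE ONE-STEP SECOND-ORDER BI-JET ACTS ON PERIODIC FORMS AS an1's SYMMETRISED KERNEL, PAIR OF BONDS BY
PAIR OF BONDS** (unfold `stepIns₂₂`, §2 per pair of bonds). -/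
theorem sum_stepIns₂₂_mul_periodic_eq_sum_bonds (hr : r ∈ box (d + 1) Lc) (w w' : ↥(pbox (fine Lc M)) × Fin (d + 1) → ℝ) (B : Form1 (d + 1) ℝ)
    (hB : ∀ (l : Fin (d + 1)) (y m : Site (d + 1)), B l (translate (fine Lc M) y m) = B l y) (x : ↥(pbox M)) (κ₀ : Fin (d + 1)) :
    ∑ q : ↥(pbox (fine Lc M)) × Fin (d + 1), stepIns₂₂ M Lc r w w' (x, κ₀) q * B q.2 (q.1 : Site (d + 1))
      = ∑ b : ↥(pbox (fine Lc M)) × Fin (d + 1), ∑ b' : ↥(pbox (fine Lc M)) × Fin (d + 1), (w b * w' b') *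
          ∑' m : Site (d + 1), ∑' n : Site (d + 1), ∑' z : Site (d + 1), ∑ l : Fin (d + 1),
            (1 / 2 : ℝ) * (vh2KerAt (toSite r) Lc κ₀ (x : Site (d + 1)) (l, z) (b.2, translate (fine Lc M) (b.1 : Site (d + 1)) m) (b'.2, translate (fine Lc M) (b'.1 : Site (d + 1)) n)
              + vh2KerAt (toSite r) Lc κ₀ (x : Site (d + 1)) (l, z) (b'.2, translate (fine Lc M) (b'.1 : Site (d + 1)) n) (b.2, translate (fine Lc M) (b.1 : Site (d + 1)) m))
            * B l z := by
  -- the per-pair torus member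
  set Tm : (↥(pbox (fine Lc M)) × Fin (d + 1)) → (↥(pbox (fine Lc M)) × Fin (d + 1)) → (↥(pbox (fine Lc M)) × Fin (d + 1)) → ℝ := fun b b' q =>
    perF (fine Lc M) (dper (fine Lc M) (fun x z a c => ∑' n : Site (d + 1), (1 / 2 : ℝ) *
      (vh₂SAt (toSite r) Lc b.2 (b.1 : Site (d + 1)) b'.2 (translate (fine Lc M) (b'.1 : Site (d + 1)) n) x z a c
        + vh₂SAt (toSite r) Lc b'.2 (translate (fine Lc M) (b'.1 : Site (d + 1)) n) b.2 (b.1 : Site (d + 1)) x z a c)))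
      (coarsePt M Lc x, Sum.inr κ₀) (q.1, Sum.inl q.2) with hTm
  have hentry : ∀ q : ↥(pbox (fine Lc M)) × Fin (d + 1), stepIns₂₂ M Lc r w w' (x, κ₀) q
      = ∑ b : ↥(pbox (fine Lc M)) × Fin (d + 1), ∑ b' : ↥(pbox (fine Lc M)) × Fin (d + 1), (w b * w' b') * Tm b b' q := fun q => by
    rw [stepIns₂₂, Matrix.sum_apply]
    exact Finset.sum_congr rfl fun b _ => by
      rw [Matrix.sum_apply]; exact Finset.sum_congr rfl fun b' _ => by rw [Matrix.smul_apply, Matrix.submatrix_apply, smul_eq_mul]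
  calc ∑ q : ↥(pbox (fine Lc M)) × Fin (d + 1), stepIns₂₂ M Lc r w w' (x, κ₀) q * B q.2 (q.1 : Site (d + 1))
      = ∑ q : ↥(pbox (fine Lc M)) × Fin (d + 1), ∑ b : ↥(pbox (fine Lc M)) × Fin (d + 1), ∑ b' : ↥(pbox (fine Lc M)) × Fin (d + 1),
          (w b * w' b') * (Tm b b' q * B q.2 (q.1 : Site (d + 1))) := by
        refine Finset.sum_congr rfl fun q _ => ?_
        rw [hentry, Finset.sum_mul]
        refine Finset.sum_congr rfl fun b _ => ?_
        rw [Finset.sum_mul]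
        exact Finset.sum_congr rfl fun b' _ => mul_assoc _ _ _
    _ = ∑ b : ↥(pbox (fine Lc M)) × Fin (d + 1), ∑ b' : ↥(pbox (fine Lc M)) × Fin (d + 1), (w b * w' b') *
          ∑ q : ↥(pbox (fine Lc M)) × Fin (d + 1), Tm b b' q * B q.2 (q.1 : Site (d + 1)) := by
        rw [Finset.sum_comm]
        refine Finset.sum_congr rfl fun b _ => ?_
        rw [Finset.sum_comm]
        exact Finset.sum_congr rfl fun b' _ => (Finset.mul_sum _ _ _).symm
    _ = _ := Finset.sum_congr rfl fun b _ => Finset.sum_congr rfl fun b' _ => by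
        rw [Fintype.sum_prod_type]
        exact congrArg (fun t : ℝ => (w b * w' b') * t) (sum_perF_dper_pair_mul_periodic M Lc hr b.2 (b.1 : Site (d + 1)) b'.2 (b'.1 : Site (d + 1)) B hB x κ₀)

/-- [folklore] **`sum_stepIns₂₂_mul_periodic` — THE ONE-STEP SECOND-ORDER BI-JET `stepIns₂₂ w w′` ACTS ON `fine Lc M`-PERIODIC 1-FORMS AS an1's SYMMETRISED ROOTED
SECOND-ORDER KERNEL SUMMED AGAINST (THE FORM, THE PERIODIC LIFTS `(κ, u) ↦ w (wrapPt (fine Lc M) u, κ)` OF THE TWO WEIGHTS)** — the order-2 twin of R-5's `sum_stepIns₁_mul_periodic`. -/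
theorem sum_stepIns₂₂_mul_periodic (hr : r ∈ box (d + 1) Lc) (w w' : ↥(pbox (fine Lc M)) × Fin (d + 1) → ℝ) (B : Form1 (d + 1) ℝ)
    (hB : ∀ (l : Fin (d + 1)) (y m : Site (d + 1)), B l (translate (fine Lc M) y m) = B l y) (x : ↥(pbox M)) (κ₀ : Fin (d + 1)) :
    ∑ q : ↥(pbox (fine Lc M)) × Fin (d + 1), stepIns₂₂ M Lc r w w' (x, κ₀) q * B q.2 (q.1 : Site (d + 1))
      = ∑' u : Site (d + 1), ∑ κ : Fin (d + 1), (∑' u' : Site (d + 1), ∑ κ' : Fin (d + 1),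
          (∑' z : Site (d + 1), ∑ l : Fin (d + 1),
            (1 / 2 : ℝ) * (vh2KerAt (toSite r) Lc κ₀ (x : Site (d + 1)) (l, z) (κ, u) (κ', u') + vh2KerAt (toSite r) Lc κ₀ (x : Site (d + 1)) (l, z) (κ', u') (κ, u)) * B l z)
          * w' (wrapPt (fine Lc M) u', κ')) * w (wrapPt (fine Lc M) u, κ) := by
  -- the lattice functional of the ordered pair of background bonds and its finite support in each bond's base
  set G : Bond (d + 1) → Bond (d + 1) → ℝ := fun g g' =>
    ∑' z : Site (d + 1), ∑ l : Fin (d + 1),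
      (1 / 2 : ℝ) * (vh2KerAt (toSite r) Lc κ₀ (x : Site (d + 1)) (l, z) g g' + vh2KerAt (toSite r) Lc κ₀ (x : Site (d + 1)) (l, z) g' g) * B l z with hG
  have hG0 : ∀ g g' : Bond (d + 1), g.2 ∉ nearBox Lc (x : Site (d + 1)) ∨ g'.2 ∉ nearBox Lc (x : Site (d + 1)) → G g g' = 0 := fun g g' h =>
    tsum_symm_vh2KerAt_mul_eq_zero_of_not_mem Lc hr κ₀ _ h B
  -- the inner lift (second weight), for a fixed first bond
  set H : Fin (d + 1) → Site (d + 1) → ℝ := fun κ u =>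
    ∑' u' : Site (d + 1), ∑ κ' : Fin (d + 1), G (κ, u) (κ', u') * w' (wrapPt (fine Lc M) u', κ') with hH
  have hH0 : ∀ (κ : Fin (d + 1)), ∀ u ∉ nearBox Lc (x : Site (d + 1)), H κ u = 0 := fun κ u hu => by
    simp only [hH]
    exact (tsum_congr fun u' => Finset.sum_eq_zero fun κ' _ => by rw [hG0 _ _ (Or.inl hu), zero_mul]).trans tsum_zero
  have hinner : ∀ (κ : Fin (d + 1)) (u : Site (d + 1)),
      ∑ b' : ↥(pbox (fine Lc M)) × Fin (d + 1), w' b' * ∑' n : Site (d + 1), G (κ, u) (b'.2, translate (fine Lc M) (b'.1 : Site (d + 1)) n) = H κ u :=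
    fun κ u => sum_mul_tsum_translate_eq_tsum_lift (fine Lc M) (fun κ' u' => G (κ, u) (κ', u')) (nearBox Lc (x : Site (d + 1)))
      (fun κ' u' hu' => hG0 _ _ (Or.inr hu')) w'
  rw [sum_stepIns₂₂_mul_periodic_eq_sum_bonds M Lc hr w w' B hB x κ₀]
  -- regroup: first bond outside, its copy sum next, then the second bond and its copies
  have hregroup : ∀ b : ↥(pbox (fine Lc M)) × Fin (d + 1),
      ∑ b' : ↥(pbox (fine Lc M)) × Fin (d + 1), (w b * w' b') *
          ∑' m : Site (d + 1), ∑' n : Site (d + 1), G (b.2, translate (fine Lc M) (b.1 : Site (d + 1)) m) (b'.2, translate (fine Lc M) (b'.1 : Site (d + 1)) n)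
        = w b * ∑' m : Site (d + 1), H b.2 (translate (fine Lc M) (b.1 : Site (d + 1)) m) := fun b => by
    -- the copies of the first bond loading the block of `x` are finitely many
    classical
    obtain ⟨Fm, hFm⟩ : ∃ F : Finset (Site (d + 1)), ∀ m ∉ F, translate (fine Lc M) (b.1 : Site (d + 1)) m ∉ nearBox Lc (x : Site (d + 1)) :=
      ⟨(nearBox Lc (x : Site (d + 1))).preimage (fun m => translate (fine Lc M) (b.1 : Site (d + 1)) m) (translate_injective (one_le_M (fine Lc M)) _).injOn,
        fun m hm hh => hm (Finset.mem_preimage.2 hh)⟩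
    have hfin : ∀ b' : ↥(pbox (fine Lc M)) × Fin (d + 1),
        (∑' m : Site (d + 1), ∑' n : Site (d + 1), G (b.2, translate (fine Lc M) (b.1 : Site (d + 1)) m) (b'.2, translate (fine Lc M) (b'.1 : Site (d + 1)) n))
          = ∑ m ∈ Fm, ∑' n : Site (d + 1), G (b.2, translate (fine Lc M) (b.1 : Site (d + 1)) m) (b'.2, translate (fine Lc M) (b'.1 : Site (d + 1)) n) := fun b' =>
      tsum_eq_sum fun m hm => (tsum_congr fun n => hG0 _ _ (Or.inl (hFm m hm))).trans tsum_zero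
    have hfinH : (∑' m : Site (d + 1), H b.2 (translate (fine Lc M) (b.1 : Site (d + 1)) m)) = ∑ m ∈ Fm, H b.2 (translate (fine Lc M) (b.1 : Site (d + 1)) m) :=
      tsum_eq_sum fun m hm => hH0 _ _ (hFm m hm)
    calc ∑ b' : ↥(pbox (fine Lc M)) × Fin (d + 1), (w b * w' b') *
          ∑' m : Site (d + 1), ∑' n : Site (d + 1), G (b.2, translate (fine Lc M) (b.1 : Site (d + 1)) m) (b'.2, translate (fine Lc M) (b'.1 : Site (d + 1)) n)
        = ∑ b' : ↥(pbox (fine Lc M)) × Fin (d + 1), ∑ m ∈ Fm, w b * (w' b' *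
            ∑' n : Site (d + 1), G (b.2, translate (fine Lc M) (b.1 : Site (d + 1)) m) (b'.2, translate (fine Lc M) (b'.1 : Site (d + 1)) n)) := by
          refine Finset.sum_congr rfl fun b' _ => ?_
          rw [hfin b', Finset.mul_sum]
          exact Finset.sum_congr rfl fun m _ => by ring
      _ = ∑ m ∈ Fm, w b * ∑ b' : ↥(pbox (fine Lc M)) × Fin (d + 1), w' b' *
            ∑' n : Site (d + 1), G (b.2, translate (fine Lc M) (b.1 : Site (d + 1)) m) (b'.2, translate (fine Lc M) (b'.1 : Site (d + 1)) n) := by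
          rw [Finset.sum_comm]
          exact Finset.sum_congr rfl fun m _ => (Finset.mul_sum _ _ _).symm
      _ = w b * ∑' m : Site (d + 1), H b.2 (translate (fine Lc M) (b.1 : Site (d + 1)) m) := by
          rw [hfinH, Finset.mul_sum]
          exact Finset.sum_congr rfl fun m _ => by rw [hinner]
  rw [Finset.sum_congr rfl fun b _ => hregroup b]
  -- the outer lift (first weight)
  rw [sum_mul_tsum_translate_eq_tsum_lift (fine Lc M) H (nearBox Lc (x : Site (d + 1))) hH0 w]

end Step

end Summit.QuantumFields.BalabanUV.Beta.FP.TorusStepInsertionPeriodicTwo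

end
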